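import Literature.Barriers.CriticalPhenomena.LongRangeTrivialityOnZ3LeeYang
import HarnessLib

/-!
# Lee–Yang lattice laws, I: the frame, and the grouping of the roots of the generating polynomial

A *Lee–Yang lattice law* of size `K` is a function `p : ℤ → ℝ` with `p ≥ 0`, `p(-k) = p(k)`,
`p_k = 0` unless `k ≡ K (mod 2)`, `∑_{|k| ≤ K} p_k = 1`, whose Laplace transform
`F(z) = ∑_{|k| ≤ K} p_k e^{zk}` vanishes only on the imaginary axis. (Example: the law of the total
spin `∑_{x ∈ Λ} σ_x` of a ferromagnetic Ising model on `K = |Λ|` sites, by the Lee–Yang circle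
theorem.) C. M. Newman (Comm. Math. Phys. 41 (1975) 1–9: Proposition 2, Theorems 3, 4, 7) derived
from the Hadamard product `E(e^{zX}) = e^{bz²} ∏ⱼ (1 + z²/αⱼ²)` a package of identities and
inequalities for such variables. The files `LeeYangLatticeLaw*.lean` of this directory prove the
LATTICE form of that package by the finite factorisation of the generating polynomial, reusing
Parts A–D of `Literature/Barriers/CriticalPhenomena/LongRangeTrivialityOnZ3LeeYang.lean`
(namespace `Literature.Barriers.CriticalPhenomena.NewmanLeeYang`: `genPoly`, `spinSum`, `mgfN`,
`norm_eq_one_of_isRoot`, `natDegree_genPoly`, the fourth-order expansions of `2 log M(t)`).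

This file contains the preliminaries:
* `exists_frame` — transport of a lattice law to the `NewmanLeeYang` frame: the support
  `S ⊆ [-K, K]` of `p` as a finite type, `K' = max_S |k| ≤ K`, the index `m_τ = (τ + K')/2` with
  `2m_τ - K' = τ`, the flip `τ ↦ -τ`, and the transfer of sums over `S` to sums over `[-K, K]`;
* `roots_genPoly_map_conj` — the generating polynomial has real coefficients, so its multiset of
  complex roots is closed under conjugation;
* `prod_map_sub_eq_pow_mul_prod` — for a conjugation-invariant multiset `R` of points of the unit
  circle other than `1`: `∏_R (u - r) = (u + 1)^m ∏_{Im r > 0} (u - r)(u - r̄)`, `#R = m + 2n`;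
* `exp_two_mul_add_one`, `exp_two_mul_sq_sub` — `e^{2z} + 1 = 2e^z cosh z` and
  `e^{4z} - 2a e^{2z} + 1 = e^{2z}(2(1 - a) + 4 sinh² z)`;
* `exists_fin_enum` — a multiset enumerated by `Fin n`.

No definitions and no named facts are introduced.

## References

* C. M. Newman, *Inequalities for Ising models and field theories which obey the Lee–Yang
  theorem*, Comm. Math. Phys. 41 (1975) 1–9, Proposition 2. [Newman1975]
-/

noncomputable section

namespace Literature.Probability.LatticeModels

open Literature.Barriers.CriticalPhenomena Finset Polynomial

namespace LeeYangLatticeLaw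

/-! ### The frame of a lattice law -/

/-- **The frame of a lattice law.** For `p ≥ 0` on `ℤ`, symmetric, vanishing off the parity class
of `K` and of mass `1` on `[-K, K]`: with `S ⊆ [-K, K]` the (finite, non-empty, symmetric) support of
`p`, `K' = max_{S} |k| ≤ K` (so `±K' ∈ S`), `m_τ = (τ + K')/2 ∈ {0, …, K'}` (an integer: every
`τ ∈ S` has the parity of `K`, as does `K'`) and the flip `ψ(τ) = -τ` of `S`, the data
`(S, p|_S, m, K')` satisfy the hypotheses of `NewmanLeeYang.newman_bounds_lattice`
(`p|_S > 0`, `∑_S p = 1`, `m ≤ K'`, `p ∘ ψ = p`, `m(ψτ) + m(τ) = K'`, `m(K') = K'`), the lattice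
variable is `N_τ = 2m_τ - K' = τ`, and a sum over `S` of any `f` vanishing where `p` does is the
sum over `[-K, K]`. [folklore] -/
theorem exists_frame (K : ℕ) (p : ℤ → ℝ) (h0 : ∀ k, 0 ≤ p k) (hsymm : ∀ k, p (-k) = p k)
    (hpar : ∀ k : ℤ, ¬ (2 ∣ (k + K)) → p k = 0) (hsum : ∑ k ∈ Icc (-(K : ℤ)) K, p k = 1) :
    ∃ (S : Finset ℤ) (K' : ℕ) (m : ↥S → ℕ) (ψ : ↥S ≃ ↥S) (τ₁ : ↥S),
      K' ≤ K ∧ (∀ τ : ↥S, 0 < p τ) ∧ (∀ τ, m τ ≤ K') ∧ (∀ τ, p (ψ τ) = p τ) ∧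
      (∀ τ, m (ψ τ) + m τ = K') ∧ m τ₁ = K' ∧ (∀ τ, NewmanLeeYang.spinSum m K' τ = ((τ : ℤ) : ℝ)) ∧
      (∀ {M : Type} [AddCommMonoid M] (f : ℤ → M), (∀ k, p k = 0 → f k = 0) →
        ∑ τ : ↥S, f τ = ∑ k ∈ Icc (-(K : ℤ)) K, f k) := by
  classical
  set S : Finset ℤ := (Icc (-(K : ℤ)) K).filter (fun k => p k ≠ 0) with hS
  have hmemS : ∀ {k : ℤ}, k ∈ S ↔ (-(K : ℤ) ≤ k ∧ k ≤ K) ∧ p k ≠ 0 := by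
    intro k; simp [hS, Finset.mem_filter, Finset.mem_Icc]
  have hnegS : ∀ {k : ℤ}, k ∈ S → -k ∈ S := by
    intro k hk
    rw [hmemS] at hk ⊢
    exact ⟨⟨by omega, by omega⟩, by rw [hsymm]; exact hk.2⟩
  have htransfer : ∀ {M : Type} [AddCommMonoid M] (f : ℤ → M), (∀ k, p k = 0 → f k = 0) →
      ∑ τ : ↥S, f τ = ∑ k ∈ Icc (-(K : ℤ)) K, f k := by
    intro M _ f hf
    rw [Finset.sum_coe_sort S f, hS, Finset.sum_filter_of_ne]
    intro k _ hk hpk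
    exact hk (hf k hpk)
  have hSne : S.Nonempty := by
    rw [Finset.nonempty_iff_ne_empty]
    intro he
    have h1 : ∑ τ : ↥S, p τ = 1 := by rw [htransfer p (fun k hk => hk), hsum]
    have h2 : ∑ τ : ↥S, p τ = 0 := by
      have : IsEmpty ↥S := by rw [he]; infer_instance
      exact Finset.sum_of_isEmpty _
    linarith
  set K' : ℕ := S.sup Int.natAbs with hK'
  have habs : ∀ k ∈ S, k.natAbs ≤ K' := fun k hk => Finset.le_sup (f := Int.natAbs) hk
  obtain ⟨k₀, hk₀S, hk₀⟩ := Finset.exists_mem_eq_sup S hSne Int.natAbs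
  have hK'S : (K' : ℤ) ∈ S := by
    rw [hK', hk₀]
    rcases Int.natAbs_eq k₀ with h | h
    · rw [← h]; exact hk₀S
    · have := hnegS hk₀S
      rwa [h, neg_neg] at this
  have hK'K : K' ≤ K := by
    rw [hK']
    refine Finset.sup_le fun k hk => ?_
    have := (hmemS.1 hk).1
    omega
  have hparS : ∀ k ∈ S, 2 ∣ k + K := fun k hk => by
    by_contra h
    exact (hmemS.1 hk).2 (hpar k h)
  have hpar' : ∀ k ∈ S, 2 ∣ k + K' ∧ 0 ≤ k + K' := fun k hk => by
    have h1 := hparS k hk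
    have h2 := hparS _ hK'S
    have h3 := habs k hk
    constructor <;> omega
  let m : ↥S → ℕ := fun τ => ((τ : ℤ) + K').toNat / 2
  have hm : ∀ τ : ↥S, (2 * (m τ : ℤ)) = τ + K' := fun τ => by
    obtain ⟨h1, h2⟩ := hpar' τ τ.2
    simp only [m]
    omega
  let ψ : ↥S ≃ ↥S :=
    { toFun := fun τ => ⟨-τ, hnegS τ.2⟩
      invFun := fun τ => ⟨-τ, hnegS τ.2⟩
      left_inv := fun τ => by simp
      right_inv := fun τ => by simp }
  refine ⟨S, K', m, ψ, ⟨K', hK'S⟩, hK'K, fun τ => lt_of_le_of_ne (h0 _) (Ne.symm (hmemS.1 τ.2).2),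
    fun τ => ?_, fun τ => hsymm _, fun τ => ?_, ?_, fun τ => ?_, htransfer⟩
  · have := hm τ
    have := habs τ τ.2
    omega
  · have h1 := hm τ
    have h2 := hm (ψ τ)
    simp only [ψ, Equiv.coe_fn_mk] at h2 ⊢
    omega
  · have := hm ⟨K', hK'S⟩
    simp only at this
    omega
  · have h1 := hm τ
    simp only [NewmanLeeYang.spinSum]
    have h2 : (2 * (m τ : ℝ)) = ((τ : ℤ) : ℝ) + K' := by exact_mod_cast h1
    linarith

/-! ### Real coefficients: the roots are closed under complex conjugation -/

/-- The generating polynomial `P(u) = ∑ p_τ u^{m_τ}` has real coefficients: it is fixed by complex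
conjugation of the coefficients. [folklore] -/
theorem genPoly_map_conj {Ω : Type*} [Fintype Ω] (p : Ω → ℝ) (m : Ω → ℕ) :
    (NewmanLeeYang.genPoly p m).map (starRingEnd ℂ) = NewmanLeeYang.genPoly p m := by
  simp [NewmanLeeYang.genPoly, Polynomial.map_sum, Polynomial.map_mul, Polynomial.map_pow,
    Complex.conj_ofReal]

/-- Hence the multiset of complex roots of `P` is invariant under conjugation. [folklore] -/
theorem roots_genPoly_map_conj {Ω : Type*} [Fintype Ω] (p : Ω → ℝ) (m : Ω → ℕ) :
    (NewmanLeeYang.genPoly p m).roots.map (starRingEnd ℂ) = (NewmanLeeYang.genPoly p m).roots := by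
  have h := (IsAlgClosed.splits (NewmanLeeYang.genPoly p m)).roots_map_of_injective
    (starRingEnd ℂ).injective
  rw [genPoly_map_conj] at h
  exact h.symm

/-! ### Grouping the roots of a real polynomial with all roots on the unit circle and `P(1) ≠ 0` -/

/-- A point of the unit circle with zero imaginary part, other than `1`, is `-1`. [folklore] -/
theorem eq_neg_one_of_norm_eq_one {r : ℂ} (hr : ‖r‖ = 1) (h1 : r ≠ 1) (him : r.im = 0) : r = -1 := by
  have hre : r.re ^ 2 = 1 := by
    have h := Complex.sq_norm r
    rw [hr, Complex.normSq_apply, him] at h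
    nlinarith [h]
  rcases mul_eq_zero.1 (show (r.re - 1) * (r.re + 1) = 0 by nlinarith [hre]) with h | h
  · exact absurd (Complex.ext (by simp; linarith) (by simp [him])) h1
  · exact Complex.ext (by simp; linarith) (by simp [him])

/-- **Grouping the roots.** For a conjugation-invariant multiset `R` of points of the unit circle,
none equal to `1`: `∏_{r ∈ R} (u - r) = (u+1)^{m} ∏_{r ∈ R, Im r > 0} (u - r)(u - r̄)` with
`m = #{r ∈ R : Im r = 0}` (these are the roots `-1`), and `#R = m + 2 #{r ∈ R : Im r > 0}`.
[folklore] -/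
theorem prod_map_sub_eq_pow_mul_prod {R : Multiset ℂ} (hR : ∀ r ∈ R, ‖r‖ = 1 ∧ r ≠ 1)
    (hconj : R.map (starRingEnd ℂ) = R) :
    (∀ u : ℂ, (R.map fun r => u - r).prod =
      (u + 1) ^ Multiset.card (R.filter fun r => r.im = 0) *
        ((R.filter fun r => 0 < r.im).map fun r => (u - r) * (u - (starRingEnd ℂ) r)).prod) ∧
    Multiset.card R =
      Multiset.card (R.filter fun r => r.im = 0) + 2 * Multiset.card (R.filter fun r => 0 < r.im) := by
  classical
  set R₀ := R.filter fun r => r.im = 0 with hR₀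
  set Rp := R.filter fun r => 0 < r.im with hRp
  set Rn := R.filter fun r => r.im < 0 with hRn
  have hsplit : R = R₀ + (Rp + Rn) := by
    rw [hR₀, hRp, hRn]
    conv_lhs => rw [← Multiset.filter_add_not (fun r : ℂ => r.im = 0) R,
      ← Multiset.filter_add_not (fun r : ℂ => 0 < r.im) (Multiset.filter (fun r : ℂ => ¬ r.im = 0) R)]
    rw [Multiset.filter_filter, Multiset.filter_filter]
    congr 2
    · exact Multiset.filter_congr fun r _ => ⟨fun h => h.1, fun h => ⟨h, h.ne'⟩⟩
    · exact Multiset.filter_congr fun r _ =>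
        ⟨fun h => lt_of_le_of_ne (not_lt.1 h.1) h.2, fun h => ⟨not_lt.2 h.le, h.ne⟩⟩
  have hneg : Rn = Rp.map (starRingEnd ℂ) := by
    rw [hRn, hRp]
    conv_lhs => rw [← hconj]
    rw [Multiset.filter_map]
    congr 1
    exact Multiset.filter_congr fun r _ => by simp [Complex.conj_im]
  refine ⟨fun u => ?_, ?_⟩
  · have e0 : (R₀.map fun r => u - r).prod = (u + 1) ^ Multiset.card R₀ := by
      rw [Multiset.map_congr rfl (fun r hr => ?_), Multiset.map_const', Multiset.prod_replicate]
      have hr' := Multiset.mem_filter.1 hr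
      obtain ⟨hn, h1⟩ := hR r hr'.1
      change u - r = u + 1
      rw [eq_neg_one_of_norm_eq_one hn h1 hr'.2]
      ring
    calc (R.map fun r => u - r).prod
        = (R₀.map fun r => u - r).prod *
            ((Rp.map fun r => u - r).prod * (Rn.map fun r => u - r).prod) := by
          conv_lhs => rw [hsplit]
          rw [Multiset.map_add, Multiset.map_add, Multiset.prod_add, Multiset.prod_add]
      _ = _ := by
          rw [e0, hneg, Multiset.map_map, ← Multiset.prod_map_mul]
          rfl
  · have h := congrArg Multiset.card hsplit
    rw [Multiset.card_add, Multiset.card_add, hneg, Multiset.card_map] at h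
    omega

/-! ### Two identities for `u = e^{2z}` -/

/-- `e^{2z} + 1 = 2e^z cosh z`. [folklore] -/
theorem exp_two_mul_add_one (z : ℂ) :
    Complex.exp (2 * z) + 1 = 2 * Complex.exp z * Complex.cosh z := by
  have h1 : Complex.exp z * Complex.exp (-z) = 1 := by
    rw [← Complex.exp_add, add_neg_cancel, Complex.exp_zero]
  have h2 : Complex.exp (2 * z) = Complex.exp z * Complex.exp z := by rw [two_mul, Complex.exp_add]
  have h3 := Complex.two_cosh z
  linear_combination h2 - Complex.exp z * h3 - h1

/-- `e^{4z} - 2a e^{2z} + 1 = e^{2z}(2(1 - a) + 4 sinh² z)`. [folklore] -/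
theorem exp_two_mul_sq_sub (z a : ℂ) :
    Complex.exp (2 * z) ^ 2 - 2 * a * Complex.exp (2 * z) + 1 =
      Complex.exp (2 * z) * (2 * (1 - a) + 4 * Complex.sinh z ^ 2) := by
  have h1 : Complex.exp z * Complex.exp (-z) = 1 := by
    rw [← Complex.exp_add, add_neg_cancel, Complex.exp_zero]
  have h2 : Complex.exp (2 * z) = Complex.exp z * Complex.exp z := by rw [two_mul, Complex.exp_add]
  have h4 : 4 * Complex.sinh z ^ 2 = (Complex.exp z - Complex.exp (-z)) ^ 2 := by
    rw [← Complex.two_sinh]; ring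
  rw [h4, h2]
  linear_combination (2 * Complex.exp z ^ 2 - Complex.exp z * Complex.exp (-z) - 1) * h1

/-! ### Enumerating a multiset by `Fin n` -/

/-- A multiset of complex numbers enumerated as `ρ : Fin n → ℂ`: products and sums over the
multiset are the corresponding `Fin n`-indexed products and sums. [folklore] -/
theorem exists_fin_enum (s : Multiset ℂ) :
    ∃ (n : ℕ) (ρ : Fin n → ℂ), n = Multiset.card s ∧ (∀ i, ρ i ∈ s) ∧
      (∀ f : ℂ → ℂ, (s.map f).prod = ∏ i, f (ρ i)) ∧ (∀ g : ℂ → ℝ, (s.map g).prod = ∏ i, g (ρ i)) ∧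
      (∀ g : ℂ → ℝ, (s.map g).sum = ∑ i, g (ρ i)) := by
  have hprod : ∀ {M : Type} [CommMonoid M] (f : ℂ → M),
      (s.map f).prod = ∏ i : Fin s.toList.length, f (s.toList[(i : ℕ)]) := by
    intro M _ f
    rw [← List.prod_ofFn, show (fun i : Fin s.toList.length => f (s.toList[(i : ℕ)])) =
      f ∘ (fun i : Fin s.toList.length => s.toList[(i : ℕ)]) from rfl, ← List.map_ofFn,
      List.ofFn_getElem, ← Multiset.prod_coe, ← Multiset.map_coe, Multiset.coe_toList]
  have hsum : ∀ {M : Type} [AddCommMonoid M] (f : ℂ → M),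
      (s.map f).sum = ∑ i : Fin s.toList.length, f (s.toList[(i : ℕ)]) := by
    intro M _ f
    rw [← List.sum_ofFn, show (fun i : Fin s.toList.length => f (s.toList[(i : ℕ)])) =
      f ∘ (fun i : Fin s.toList.length => s.toList[(i : ℕ)]) from rfl, ← List.map_ofFn,
      List.ofFn_getElem, ← Multiset.sum_coe, ← Multiset.map_coe, Multiset.coe_toList]
  exact ⟨s.toList.length, fun i => s.toList[(i : ℕ)], Multiset.length_toList s,
    fun i => Multiset.mem_toList.1 (List.getElem_mem i.2), fun f => hprod f, fun g => hprod g,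
    fun g => hsum g⟩

end LeeYangLatticeLaw

end Literature.Probability.LatticeModels
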